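import Summits.CriticalPhenomena.Ising3D.Control2DBoxCells
import Summits.CriticalPhenomena.Ising3D.Control2DL11BoxGData1
import Summits.CriticalPhenomena.Ising3D.Control2DL11BoxGData10
import Summits.CriticalPhenomena.Ising3D.Control2DL11BoxGData2
import Summits.CriticalPhenomena.Ising3D.Control2DL11BoxGData3
import Summits.CriticalPhenomena.Ising3D.Control2DL11BoxGData4
import Summits.CriticalPhenomena.Ising3D.Control2DL11BoxGData5
import Summits.CriticalPhenomena.Ising3D.Control2DL11BoxGData6
import Summits.CriticalPhenomena.Ising3D.Control2DL11BoxGData7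
import Summits.CriticalPhenomena.Ising3D.Control2DL11BoxGData8
import Summits.CriticalPhenomena.Ising3D.Control2DL11BoxGData9
import Mathlib.Tactic.IntervalCases
import Mathlib.Tactic.Linarith
import Mathlib.Tactic.NormNum
import HarnessLib

/-!
# Kernel replay of the RB-2 certificate `j110210_functional_deriv2d_L11_E032_sig1o8_box0.8-0.86.json` (Λ = 11, E₀ = 32): Δ_ε ∉ [4/5, 43/50] at Δ_σ = 1/8 under A2D′: the cells as ONE theorem
(cell `pub-ising3x`, seat controls-1 gen 16; KERNEL PATH for the 2D γ-certificates, Λ = 11 — CONTROL-ONLY)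

HONEST FRAMING: lottery ticket; floor = tightest certified 3D Ising CFT bounds; no exact-solution
claim without a proof. CONTROL-ONLY (`d = 2`, `Δ_σ = 1/8`; axiom set A2D′).

`cells_boxG`: every cell obligation of the certificate ((E) on the ε box, (C′) scalars on [2, 32), the stress-tensor point (T), spin 2 on [3, 32), even spins 4…30 on [ℓ, 32)), in the witness form `∃ N ≥ E₀` with the spin's own truncation
order, from the kernel-decided Bernstein leaves of `Control2DL11BoxGData*` via `cell_nonneg_of_bernCheck`. No facts, standard axioms only.
-/

namespace Summit.CriticalPhenomena.Ising3D.Control2D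

open Finset Set
open Literature.MathematicalPhysics.QuantumFieldTheory.ConformalBootstrap3D

set_option maxHeartbeats 0 in
/-- **The cells of the certificate** (Δ_ε ∉ [4/5, 43/50] at Δ_σ = 1/8 under A2D′; `E₀ = 32`; truncation `N = Nd + 1` per spin:
ℓ=0: 48, ℓ=2: 40, ℓ=4: 40, ℓ=6: 40, ℓ=8: 40, ℓ=10: 40 ; others `N = 32`). [folklore] -/
theorem cells_boxG :
    BoxCellsN slL11.toFinset (fun p => (wtboxG p : ℝ)) (1 / 8) 2 1 (4 / 5) (43 / 50) 32 := by
  refine ⟨?_, ?_, ?_, ?_, ?_⟩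
  · intro Δ h1 h2
    refine ⟨48, by norm_num, ?_⟩
    exact cell_nonneg_of_bernAuto_trunc wtboxG slL11_nodup slL11_deg 0 47 281 (q := 100) (a := 40)
        (L := 3) (by norm_num) (by norm_num) (by norm_num) (by rw [phatboxGs0_eq]; exact cellChk_boxG_s0l0)
        (by norm_num; linarith) (by norm_num; linarith)
  · intro Δ h1 h2
    replace h2 := h2.le
    refine ⟨48, by norm_num, ?_⟩
    rcases le_or_gt Δ ((31 : ℝ) / 8) with hd0 | hd0
    · exact cell_nonneg_of_bernAuto_trunc wtboxG slL11_nodup slL11_deg 0 47 281 (q := 16) (a := 16)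
        (L := 15) (by norm_num) (by norm_num) (by norm_num) (by rw [phatboxGs0_eq]; exact cellChk_boxG_s0l1)
        (by norm_num; linarith) (by norm_num; linarith)
    rcases le_or_gt Δ ((77 : ℝ) / 16) with hd1 | hd1
    · exact cell_nonneg_of_bernAuto_trunc wtboxG slL11_nodup slL11_deg 0 47 281 (q := 32) (a := 62)
        (L := 15) (by norm_num) (by norm_num) (by norm_num) (by rw [phatboxGs0_eq]; exact cellChk_boxG_s0l2)
        (by norm_num; linarith) (by norm_num; linarith)
    rcases le_or_gt Δ ((323 : ℝ) / 64) with hd2 | hd2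
    · exact cell_nonneg_of_bernAuto_trunc wtboxG slL11_nodup slL11_deg 0 47 281 (q := 128) (a := 308)
        (L := 15) (by norm_num) (by norm_num) (by norm_num) (by rw [phatboxGs0_eq]; exact cellChk_boxG_s0l3)
        (by norm_num; linarith) (by norm_num; linarith)
    rcases le_or_gt Δ ((169 : ℝ) / 32) with hd3 | hd3
    · exact cell_nonneg_of_bernAuto_trunc wtboxG slL11_nodup slL11_deg 0 47 281 (q := 128) (a := 323)
        (L := 15) (by norm_num) (by norm_num) (by norm_num) (by rw [phatboxGs0_eq]; exact cellChk_boxG_s0l4)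
        (by norm_num; linarith) (by norm_num; linarith)
    rcases le_or_gt Δ ((23 : ℝ) / 4) with hd4 | hd4
    · exact cell_nonneg_of_bernAuto_trunc wtboxG slL11_nodup slL11_deg 0 47 281 (q := 64) (a := 169)
        (L := 15) (by norm_num) (by norm_num) (by norm_num) (by rw [phatboxGs0_eq]; exact cellChk_boxG_s0l5)
        (by norm_num; linarith) (by norm_num; linarith)
    rcases le_or_gt Δ ((19 : ℝ) / 2) with hd5 | hd5
    · exact cell_nonneg_of_bernAuto_trunc wtboxG slL11_nodup slL11_deg 0 47 281 (q := 8) (a := 23)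
        (L := 15) (by norm_num) (by norm_num) (by norm_num) (by rw [phatboxGs0_eq]; exact cellChk_boxG_s0l6)
        (by norm_num; linarith) (by norm_num; linarith)
    rcases le_or_gt Δ (17 : ℝ) with hd6 | hd6
    · exact cell_nonneg_of_bernAuto_trunc wtboxG slL11_nodup slL11_deg 0 47 281 (q := 4) (a := 19)
        (L := 15) (by norm_num) (by norm_num) (by norm_num) (by rw [phatboxGs0_eq]; exact cellChk_boxG_s0l7)
        (by norm_num; linarith) (by norm_num; linarith)
    exact cell_nonneg_of_bernAuto_trunc wtboxG slL11_nodup slL11_deg 0 47 281 (q := 2) (a := 17)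
        (L := 15) (by norm_num) (by norm_num) (by norm_num) (by rw [phatboxGs0_eq]; exact cellChk_boxG_s0l8)
        (by norm_num; linarith) (by norm_num; linarith)
  · refine ⟨40, by norm_num, ?_⟩
    exact cell_nonneg_of_bernAuto_trunc wtboxG slL11_nodup slL11_deg 2 39 229 (q := 1) (a := 0)
        (L := 0) (by norm_num) (by norm_num) (by norm_num) (by rw [phatboxGs2_eq]; exact cellChk_boxG_s2l0)
        (by norm_num) (by norm_num)
  · intro Δ h1 h2
    replace h1 : (3 : ℝ) ≤ Δ := by linarith
    replace h2 := h2.le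
    refine ⟨40, by norm_num, ?_⟩
    rcases le_or_gt Δ ((41 : ℝ) / 4) with hd0 | hd0
    · exact cell_nonneg_of_bernAuto_trunc wtboxG slL11_nodup slL11_deg 2 39 229 (q := 8) (a := 4)
        (L := 29) (by norm_num) (by norm_num) (by norm_num) (by rw [phatboxGs2_eq]; exact cellChk_boxG_s2l1)
        (by norm_num; linarith) (by norm_num; linarith)
    rcases le_or_gt Δ ((35 : ℝ) / 2) with hd1 | hd1
    · exact cell_nonneg_of_bernAuto_trunc wtboxG slL11_nodup slL11_deg 2 39 229 (q := 8) (a := 33)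
        (L := 29) (by norm_num) (by norm_num) (by norm_num) (by rw [phatboxGs2_eq]; exact cellChk_boxG_s2l2)
        (by norm_num; linarith) (by norm_num; linarith)
    exact cell_nonneg_of_bernAuto_trunc wtboxG slL11_nodup slL11_deg 2 39 229 (q := 4) (a := 31)
        (L := 29) (by norm_num) (by norm_num) (by norm_num) (by rw [phatboxGs2_eq]; exact cellChk_boxG_s2l3)
        (by norm_num; linarith) (by norm_num; linarith)
  · intro ℓ hℓ hℓ0 hℓ2 Δ hℓΔ hΔ
    have hℓR : (ℓ : ℝ) < 32 := lt_of_le_of_lt hℓΔ hΔ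
    have hℓ32 : ℓ < 32 := by exact_mod_cast hℓR
    replace h2 := hΔ.le
    interval_cases ℓ
    · exact absurd rfl hℓ0
    · exact absurd hℓ (by decide)
    · exact absurd rfl hℓ2
    · exact absurd hℓ (by decide)
    · have h1 : (4 : ℝ) ≤ Δ := by exact_mod_cast hℓΔ
      refine ⟨40, by norm_num, ?_⟩
      rcases le_or_gt Δ ((23 : ℝ) / 4) with hd0 | hd0
      · exact cell_nonneg_of_bernAuto_trunc wtboxG slL11_nodup slL11_deg 4 39 233 (q := 8) (a := 0)
          (L := 7) (by norm_num) (by norm_num) (by norm_num) (by rw [phatboxGs4_eq]; exact cellChk_boxG_s4l0)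
          (by norm_num; linarith) (by norm_num; linarith)
      rcases le_or_gt Δ ((53 : ℝ) / 8) with hd1 | hd1
      · exact cell_nonneg_of_bernAuto_trunc wtboxG slL11_nodup slL11_deg 4 39 233 (q := 16) (a := 14)
          (L := 7) (by norm_num) (by norm_num) (by norm_num) (by rw [phatboxGs4_eq]; exact cellChk_boxG_s4l1)
          (by norm_num; linarith) (by norm_num; linarith)
      rcases le_or_gt Δ ((15 : ℝ) / 2) with hd2 | hd2
      · exact cell_nonneg_of_bernAuto_trunc wtboxG slL11_nodup slL11_deg 4 39 233 (q := 16) (a := 21)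
          (L := 7) (by norm_num) (by norm_num) (by norm_num) (by rw [phatboxGs4_eq]; exact cellChk_boxG_s4l2)
          (by norm_num; linarith) (by norm_num; linarith)
      rcases le_or_gt Δ (11 : ℝ) with hd3 | hd3
      · exact cell_nonneg_of_bernAuto_trunc wtboxG slL11_nodup slL11_deg 4 39 233 (q := 4) (a := 7)
          (L := 7) (by norm_num) (by norm_num) (by norm_num) (by rw [phatboxGs4_eq]; exact cellChk_boxG_s4l3)
          (by norm_num; linarith) (by norm_num; linarith)
      rcases le_or_gt Δ (18 : ℝ) with hd4 | hd4
      · exact cell_nonneg_of_bernAuto_trunc wtboxG slL11_nodup slL11_deg 4 39 233 (q := 2) (a := 7)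
          (L := 7) (by norm_num) (by norm_num) (by norm_num) (by rw [phatboxGs4_eq]; exact cellChk_boxG_s4l4)
          (by norm_num; linarith) (by norm_num; linarith)
      exact cell_nonneg_of_bernAuto_trunc wtboxG slL11_nodup slL11_deg 4 39 233 (q := 1) (a := 7)
          (L := 7) (by norm_num) (by norm_num) (by norm_num) (by rw [phatboxGs4_eq]; exact cellChk_boxG_s4l5)
          (by norm_num; linarith) (by norm_num; linarith)
    · exact absurd hℓ (by decide)
    · have h1 : (6 : ℝ) ≤ Δ := by exact_mod_cast hℓΔ
      refine ⟨40, by norm_num, ?_⟩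
      rcases le_or_gt Δ ((109 : ℝ) / 16) with hd0 | hd0
      · exact cell_nonneg_of_bernAuto_trunc wtboxG slL11_nodup slL11_deg 6 39 237 (q := 32) (a := 0)
          (L := 13) (by norm_num) (by norm_num) (by norm_num) (by rw [phatboxGs6_eq]; exact cellChk_boxG_s6l0)
          (by norm_num; linarith) (by norm_num; linarith)
      rcases le_or_gt Δ ((61 : ℝ) / 8) with hd1 | hd1
      · exact cell_nonneg_of_bernAuto_trunc wtboxG slL11_nodup slL11_deg 6 39 237 (q := 32) (a := 13)
          (L := 13) (by norm_num) (by norm_num) (by norm_num) (by rw [phatboxGs6_eq]; exact cellChk_boxG_s6l1)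
          (by norm_num; linarith) (by norm_num; linarith)
      rcases le_or_gt Δ ((37 : ℝ) / 4) with hd2 | hd2
      · exact cell_nonneg_of_bernAuto_trunc wtboxG slL11_nodup slL11_deg 6 39 237 (q := 16) (a := 13)
          (L := 13) (by norm_num) (by norm_num) (by norm_num) (by rw [phatboxGs6_eq]; exact cellChk_boxG_s6l2)
          (by norm_num; linarith) (by norm_num; linarith)
      rcases le_or_gt Δ ((25 : ℝ) / 2) with hd3 | hd3
      · exact cell_nonneg_of_bernAuto_trunc wtboxG slL11_nodup slL11_deg 6 39 237 (q := 8) (a := 13)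
          (L := 13) (by norm_num) (by norm_num) (by norm_num) (by rw [phatboxGs6_eq]; exact cellChk_boxG_s6l3)
          (by norm_num; linarith) (by norm_num; linarith)
      rcases le_or_gt Δ (19 : ℝ) with hd4 | hd4
      · exact cell_nonneg_of_bernAuto_trunc wtboxG slL11_nodup slL11_deg 6 39 237 (q := 4) (a := 13)
          (L := 13) (by norm_num) (by norm_num) (by norm_num) (by rw [phatboxGs6_eq]; exact cellChk_boxG_s6l4)
          (by norm_num; linarith) (by norm_num; linarith)
      exact cell_nonneg_of_bernAuto_trunc wtboxG slL11_nodup slL11_deg 6 39 237 (q := 2) (a := 13)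
          (L := 13) (by norm_num) (by norm_num) (by norm_num) (by rw [phatboxGs6_eq]; exact cellChk_boxG_s6l5)
          (by norm_num; linarith) (by norm_num; linarith)
    · exact absurd hℓ (by decide)
    · have h1 : (8 : ℝ) ≤ Δ := by exact_mod_cast hℓΔ
      refine ⟨40, by norm_num, ?_⟩
      rcases le_or_gt Δ ((19 : ℝ) / 2) with hd0 | hd0
      · exact cell_nonneg_of_bernAuto_trunc wtboxG slL11_nodup slL11_deg 8 39 241 (q := 4) (a := 0)
          (L := 3) (by norm_num) (by norm_num) (by norm_num) (by rw [phatboxGs8_eq]; exact cellChk_boxG_s8l0)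
          (by norm_num; linarith) (by norm_num; linarith)
      rcases le_or_gt Δ (11 : ℝ) with hd1 | hd1
      · exact cell_nonneg_of_bernAuto_trunc wtboxG slL11_nodup slL11_deg 8 39 241 (q := 4) (a := 3)
          (L := 3) (by norm_num) (by norm_num) (by norm_num) (by rw [phatboxGs8_eq]; exact cellChk_boxG_s8l1)
          (by norm_num; linarith) (by norm_num; linarith)
      rcases le_or_gt Δ (14 : ℝ) with hd2 | hd2
      · exact cell_nonneg_of_bernAuto_trunc wtboxG slL11_nodup slL11_deg 8 39 241 (q := 2) (a := 3)
          (L := 3) (by norm_num) (by norm_num) (by norm_num) (by rw [phatboxGs8_eq]; exact cellChk_boxG_s8l2)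
          (by norm_num; linarith) (by norm_num; linarith)
      rcases le_or_gt Δ (20 : ℝ) with hd3 | hd3
      · exact cell_nonneg_of_bernAuto_trunc wtboxG slL11_nodup slL11_deg 8 39 241 (q := 1) (a := 3)
          (L := 3) (by norm_num) (by norm_num) (by norm_num) (by rw [phatboxGs8_eq]; exact cellChk_boxG_s8l3)
          (by norm_num; linarith) (by norm_num; linarith)
      exact cell_nonneg_of_bernAuto_trunc wtboxG slL11_nodup slL11_deg 8 39 241 (q := 1) (a := 6)
          (L := 6) (by norm_num) (by norm_num) (by norm_num) (by rw [phatboxGs8_eq]; exact cellChk_boxG_s8l4)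
          (by norm_num; linarith) (by norm_num; linarith)
    · exact absurd hℓ (by decide)
    · have h1 : (10 : ℝ) ≤ Δ := by exact_mod_cast hℓΔ
      refine ⟨40, by norm_num, ?_⟩
      rcases le_or_gt Δ ((31 : ℝ) / 2) with hd0 | hd0
      · exact cell_nonneg_of_bernAuto_trunc wtboxG slL11_nodup slL11_deg 10 39 244 (q := 4) (a := 0)
          (L := 11) (by norm_num) (by norm_num) (by norm_num) (by rw [phatboxGs10_eq]; exact cellChk_boxG_s10l0)
          (by norm_num; linarith) (by norm_num; linarith)
      rcases le_or_gt Δ (21 : ℝ) with hd1 | hd1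
      · exact cell_nonneg_of_bernAuto_trunc wtboxG slL11_nodup slL11_deg 10 39 244 (q := 4) (a := 11)
          (L := 11) (by norm_num) (by norm_num) (by norm_num) (by rw [phatboxGs10_eq]; exact cellChk_boxG_s10l1)
          (by norm_num; linarith) (by norm_num; linarith)
      exact cell_nonneg_of_bernAuto_trunc wtboxG slL11_nodup slL11_deg 10 39 244 (q := 2) (a := 11)
          (L := 11) (by norm_num) (by norm_num) (by norm_num) (by rw [phatboxGs10_eq]; exact cellChk_boxG_s10l2)
          (by norm_num; linarith) (by norm_num; linarith)
    · exact absurd hℓ (by decide)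
    · have h1 : (12 : ℝ) ≤ Δ := by exact_mod_cast hℓΔ
      refine ⟨32, by norm_num, ?_⟩
      exact cell_nonneg_of_bernAuto_trunc wtboxG slL11_nodup slL11_deg 12 31 191 (q := 1) (a := 0)
          (L := 10) (by norm_num) (by norm_num) (by norm_num) (by rw [phatboxGs12_eq]; exact cellChk_boxG_s12l0)
          (by norm_num; linarith) (by norm_num; linarith)
    · exact absurd hℓ (by decide)
    · have h1 : (14 : ℝ) ≤ Δ := by exact_mod_cast hℓΔ
      refine ⟨32, by norm_num, ?_⟩
      exact cell_nonneg_of_bernAuto_trunc wtboxG slL11_nodup slL11_deg 14 31 193 (q := 1) (a := 0)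
          (L := 9) (by norm_num) (by norm_num) (by norm_num) (by rw [phatboxGs14_eq]; exact cellChk_boxG_s14l0)
          (by norm_num; linarith) (by norm_num; linarith)
    · exact absurd hℓ (by decide)
    · have h1 : (16 : ℝ) ≤ Δ := by exact_mod_cast hℓΔ
      refine ⟨32, by norm_num, ?_⟩
      exact cell_nonneg_of_bernAuto_trunc wtboxG slL11_nodup slL11_deg 16 31 195 (q := 1) (a := 0)
          (L := 8) (by norm_num) (by norm_num) (by norm_num) (by rw [phatboxGs16_eq]; exact cellChk_boxG_s16l0)
          (by norm_num; linarith) (by norm_num; linarith)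
    · exact absurd hℓ (by decide)
    · have h1 : (18 : ℝ) ≤ Δ := by exact_mod_cast hℓΔ
      refine ⟨32, by norm_num, ?_⟩
      exact cell_nonneg_of_bernAuto_trunc wtboxG slL11_nodup slL11_deg 18 31 197 (q := 1) (a := 0)
          (L := 7) (by norm_num) (by norm_num) (by norm_num) (by rw [phatboxGs18_eq]; exact cellChk_boxG_s18l0)
          (by norm_num; linarith) (by norm_num; linarith)
    · exact absurd hℓ (by decide)
    · have h1 : (20 : ℝ) ≤ Δ := by exact_mod_cast hℓΔ
      refine ⟨32, by norm_num, ?_⟩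
      exact cell_nonneg_of_bernAuto_trunc wtboxG slL11_nodup slL11_deg 20 31 198 (q := 1) (a := 0)
          (L := 6) (by norm_num) (by norm_num) (by norm_num) (by rw [phatboxGs20_eq]; exact cellChk_boxG_s20l0)
          (by norm_num; linarith) (by norm_num; linarith)
    · exact absurd hℓ (by decide)
    · have h1 : (22 : ℝ) ≤ Δ := by exact_mod_cast hℓΔ
      refine ⟨32, by norm_num, ?_⟩
      exact cell_nonneg_of_bernAuto_trunc wtboxG slL11_nodup slL11_deg 22 31 200 (q := 1) (a := 0)
          (L := 5) (by norm_num) (by norm_num) (by norm_num) (by rw [phatboxGs22_eq]; exact cellChk_boxG_s22l0)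
          (by norm_num; linarith) (by norm_num; linarith)
    · exact absurd hℓ (by decide)
    · have h1 : (24 : ℝ) ≤ Δ := by exact_mod_cast hℓΔ
      refine ⟨32, by norm_num, ?_⟩
      exact cell_nonneg_of_bernAuto_trunc wtboxG slL11_nodup slL11_deg 24 31 202 (q := 1) (a := 0)
          (L := 4) (by norm_num) (by norm_num) (by norm_num) (by rw [phatboxGs24_eq]; exact cellChk_boxG_s24l0)
          (by norm_num; linarith) (by norm_num; linarith)
    · exact absurd hℓ (by decide)
    · have h1 : (26 : ℝ) ≤ Δ := by exact_mod_cast hℓΔ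
      refine ⟨32, by norm_num, ?_⟩
      exact cell_nonneg_of_bernAuto_trunc wtboxG slL11_nodup slL11_deg 26 31 203 (q := 1) (a := 0)
          (L := 3) (by norm_num) (by norm_num) (by norm_num) (by rw [phatboxGs26_eq]; exact cellChk_boxG_s26l0)
          (by norm_num; linarith) (by norm_num; linarith)
    · exact absurd hℓ (by decide)
    · have h1 : (28 : ℝ) ≤ Δ := by exact_mod_cast hℓΔ
      refine ⟨32, by norm_num, ?_⟩
      exact cell_nonneg_of_bernAuto_trunc wtboxG slL11_nodup slL11_deg 28 31 204 (q := 1) (a := 0)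
          (L := 2) (by norm_num) (by norm_num) (by norm_num) (by rw [phatboxGs28_eq]; exact cellChk_boxG_s28l0)
          (by norm_num; linarith) (by norm_num; linarith)
    · exact absurd hℓ (by decide)
    · have h1 : (30 : ℝ) ≤ Δ := by exact_mod_cast hℓΔ
      refine ⟨32, by norm_num, ?_⟩
      exact cell_nonneg_of_bernAuto_trunc wtboxG slL11_nodup slL11_deg 30 31 206 (q := 1) (a := 0)
          (L := 1) (by norm_num) (by norm_num) (by norm_num) (by rw [phatboxGs30_eq]; exact cellChk_boxG_s30l0)
          (by norm_num; linarith) (by norm_num; linarith)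
    · exact absurd hℓ (by decide)

end Summit.CriticalPhenomena.Ising3D.Control2D
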